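import Summits.QuantumFields.GaugeBoot.PlaquetteGradientIdentity
import Summits.QuantumFields.GaugeBoot.PlanarRelaxationWordCut
import HarnessLib

/-!
# Gauge-boot: the SUM-OF-SQUARES certificate behind the equipartition bound —
# `16(d−1)·Σ cost − ‖M − Mᴴ‖²` is an explicit sum of squared Hilbert–Schmidt norms of level-4 word matrices
# (large-`N` supplement 18, part 5b)

HONEST FRAMING (cell `pub-gaugeboot`, page 1 of every file): certified bounds on lattice
expectations at STATED coupling, gauge group, dimension and torus size; NOT a mass gap, NOT a
continuum limit, NOT a string tension, NOT large `N`; NOT Yang–Mills-summit-bearing (barriers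
`FixedCouplingUltralocality`, `PerturbativeInvisibility`).  Pointwise matrix algebra and word-degree
bookkeeping; it certifies no number.

## Content

For the `2(d−1)` plaquette holonomies `V_{ν,ε} = ρ(hol P̃_{ν,ε})` through an edge (`M = plaqSum = Σ V`,
`B_{ν,ε} = V − Vᴴ`, `A = M − Mᴴ = Σ B`), with unitary `ρ`:

* `norm_sq_add_conjTranspose_add` — `‖P + Pᴴ‖² + ‖P − Pᴴ‖² = 4‖P‖²` (Hilbert–Schmidt);
  `card_mul_sum_norm_sub_avg_sq` — the variance identity `n·Σᵢ‖Bᵢ − A/n‖² = n·Σᵢ‖Bᵢ‖² − ‖A‖²` (`n = #s`);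
* ★★ `sos_identity` — **`16(d−1)·Σ_{ν,ε}(N − Re tr V_{ν,ε}) − ‖A‖² =
  2(d−1)·Σ_{ν,ε}‖(1 − V_{ν,ε}) + (1 − V_{ν,ε})ᴴ‖² + 2(d−1)·Σ_{ν,ε}‖B_{ν,ε} − A/(2(d−1))‖²`** — the inequality
  `‖A‖²/2 ≤ 8(d−1)Σ cost` of part 4a (`norm_sq_plaqSum_sub_star_le`) as an explicit SOS;
* `EntriesIn` bookkeeping (`entriesIn_const`, `EntriesIn.add/neg/sub/smul_real/conjTranspose/sum/mono`,
  `entriesIn_plaqWord`, `entriesIn_plaqSum`) — every matrix in the certificate has entries that are word functions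
  of degree `4` (`WordSpaces`), so its squared norm is a sum of squares of level-4 test functions of the lane's
  word SDP (used in part 5c).
[folklore]
-/

noncomputable section

open scoped Matrix.Norms.Frobenius Matrix
open Literature.MathematicalPhysics.QuantumFieldTheory

namespace Summit.QuantumFields.GaugeBoot

namespace Equipartition

/-! ## Hilbert–Schmidt algebra -/

section HS

variable {N : ℕ}

/-- `‖M‖² = Re tr(Mᴴ M)` (the tree's `Matrix.frobenius_norm_sq_eq_re_trace`, `Complex.re` form). [folklore] -/
theorem norm_sq_eq_re_trace (M : Matrix (Fin N) (Fin N) ℂ) : ‖M‖ ^ 2 = (Mᴴ * M).trace.re := by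
  rw [Matrix.frobenius_norm_sq_eq_re_trace]; rfl

/-- `‖P − Q‖² = ‖P‖² + ‖Q‖² − 2 Re tr(Pᴴ Q)`. [folklore] -/
theorem norm_sub_sq_eq (P Q : Matrix (Fin N) (Fin N) ℂ) :
    ‖P - Q‖ ^ 2 = ‖P‖ ^ 2 + ‖Q‖ ^ 2 - 2 * (Pᴴ * Q).trace.re := by
  have h : (Qᴴ * P).trace = star ((Pᴴ * Q).trace) := by
    rw [← Matrix.trace_conjTranspose, Matrix.conjTranspose_mul, Matrix.conjTranspose_conjTranspose]
  rw [norm_sq_eq_re_trace, norm_sq_eq_re_trace, norm_sq_eq_re_trace, Matrix.conjTranspose_sub, Matrix.sub_mul,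
    Matrix.mul_sub, Matrix.mul_sub, Matrix.trace_sub, Matrix.trace_sub, Matrix.trace_sub, h, Complex.star_def]
  simp only [Complex.sub_re, Complex.conj_re]
  ring

/-- `‖P + Q‖² = ‖P‖² + ‖Q‖² + 2 Re tr(Pᴴ Q)`. [folklore] -/
theorem norm_add_sq_eq (P Q : Matrix (Fin N) (Fin N) ℂ) :
    ‖P + Q‖ ^ 2 = ‖P‖ ^ 2 + ‖Q‖ ^ 2 + 2 * (Pᴴ * Q).trace.re := by
  have h := norm_sub_sq_eq P (-Q)
  rw [sub_neg_eq_add, norm_neg, Matrix.mul_neg, Matrix.trace_neg, Complex.neg_re] at h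
  linarith

/-- `‖P + Pᴴ‖² + ‖P − Pᴴ‖² = 4‖P‖²`. [folklore] -/
theorem norm_sq_add_conjTranspose_add (P : Matrix (Fin N) (Fin N) ℂ) :
    ‖P + Pᴴ‖ ^ 2 + ‖P - Pᴴ‖ ^ 2 = 4 * ‖P‖ ^ 2 := by
  rw [norm_add_sq_eq, norm_sub_sq_eq, Matrix.frobenius_norm_conjTranspose]
  ring

/-- **Variance identity**: `n·Σᵢ‖Bᵢ − A/n‖² = n·Σᵢ‖Bᵢ‖² − ‖A‖²` for a family over a finite set of size `n > 0`
with `A = Σᵢ Bᵢ`. [folklore] -/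
theorem card_mul_sum_norm_sub_avg_sq {ι : Type*} (s : Finset ι) (hs : s.Nonempty) (B : ι → Matrix (Fin N) (Fin N) ℂ) :
    (s.card : ℝ) * ∑ i ∈ s, ‖B i - (((s.card : ℝ)⁻¹ : ℝ) : ℂ) • ∑ j ∈ s, B j‖ ^ 2 =
      (s.card : ℝ) * ∑ i ∈ s, ‖B i‖ ^ 2 - ‖∑ j ∈ s, B j‖ ^ 2 := by
  set A := ∑ j ∈ s, B j with hA
  set n : ℝ := (s.card : ℝ) with hn
  have hn0 : n ≠ 0 := by rw [hn]; exact_mod_cast hs.card_pos.ne'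
  have hterm : ∀ i, ‖B i - (((n⁻¹ : ℝ)) : ℂ) • A‖ ^ 2 = ‖B i‖ ^ 2 + n⁻¹ ^ 2 * ‖A‖ ^ 2 - 2 * n⁻¹ * ((B i)ᴴ * A).trace.re := by
    intro i
    rw [norm_sub_sq_eq, Matrix.mul_smul, Matrix.trace_smul, smul_eq_mul, Complex.re_ofReal_mul, norm_smul,
      Complex.norm_real, Real.norm_eq_abs, abs_of_nonneg (by positivity), mul_pow]
    ring
  have hsum : ∑ i ∈ s, ((B i)ᴴ * A).trace.re = ‖A‖ ^ 2 := by
    rw [norm_sq_eq_re_trace, hA, Matrix.conjTranspose_sum, Finset.sum_mul, Matrix.trace_sum, Complex.re_sum]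
  simp only [hterm, Finset.sum_sub_distrib, Finset.sum_add_distrib, Finset.sum_const, nsmul_eq_mul, ← Finset.mul_sum, hsum]
  rw [← hn]
  field_simp
  ring

end HS

/-! ## The sum-of-squares identity for the plaquettes through an edge -/

section SOS

variable {d L N : ℕ} {G : Type} [Group G] {ρ : G →* Matrix (Fin N) (Fin N) ℂ}

/-- The index set of the plaquette words through `(x, μ)` has `2(d−1)` elements. [folklore] -/
theorem card_plaqIndex (μ : Fin d) :
    (((Finset.univ.erase μ) ×ˢ (Finset.univ : Finset Bool)).card : ℝ) = 2 * ((d : ℝ) - 1) := by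
  rw [Finset.card_product, Finset.card_erase_of_mem (Finset.mem_univ μ), Finset.card_univ, Fintype.card_fin,
    Finset.card_univ, Fintype.card_bool, Nat.cast_mul, Nat.cast_sub (Fin.pos μ), Nat.cast_ofNat, Nat.cast_one]
  ring

/-- `plaqSum` as a sum over the product index set. [folklore] -/
theorem plaqSum_eq_sum_product (x : Site d L) (μ : Fin d) (U : GaugeConfig d L G) :
    plaqSum ρ x μ U = ∑ p ∈ (Finset.univ.erase μ) ×ˢ (Finset.univ : Finset Bool), ρ (wordHolonomy U x (plaqWord μ p.1 p.2)) := by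
  rw [plaqSum, Finset.sum_product]

/-- ★★ **THE SOS IDENTITY.**  With `V_p = ρ(hol P̃_p)` (`p = (ν, ε)`), `B_p = V_p − V_pᴴ`, `A = Σ_p B_p = M − Mᴴ`, `n = 2(d−1)`,
for unitary `ρ` and `d ≥ 2`:
`16(d−1)·Σ_p (N − Re tr V_p) − ‖A‖² = 2(d−1)·Σ_p ‖(1 − V_p) + (1 − V_p)ᴴ‖² + 2(d−1)·Σ_p ‖B_p − A/(2(d−1))‖²`. [folklore] -/
theorem sos_identity (hρ : ∀ g, ρ g ∈ Matrix.unitaryGroup (Fin N) ℂ) (hd : 2 ≤ d) (x : Site d L) (μ : Fin d)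
    (U : GaugeConfig d L G) :
    16 * ((d : ℝ) - 1) * (∑ p ∈ (Finset.univ.erase μ) ×ˢ (Finset.univ : Finset Bool),
        ((N : ℝ) - (ρ (wordHolonomy U x (plaqWord μ p.1 p.2))).trace.re)) -
      ‖plaqSum ρ x μ U - (plaqSum ρ x μ U)ᴴ‖ ^ 2 =
    2 * ((d : ℝ) - 1) * (∑ p ∈ (Finset.univ.erase μ) ×ˢ (Finset.univ : Finset Bool),
        ‖((1 : Matrix (Fin N) (Fin N) ℂ) - ρ (wordHolonomy U x (plaqWord μ p.1 p.2))) +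
          ((1 : Matrix (Fin N) (Fin N) ℂ) - ρ (wordHolonomy U x (plaqWord μ p.1 p.2)))ᴴ‖ ^ 2) +
    2 * ((d : ℝ) - 1) * (∑ p ∈ (Finset.univ.erase μ) ×ˢ (Finset.univ : Finset Bool),
        ‖(ρ (wordHolonomy U x (plaqWord μ p.1 p.2)) - (ρ (wordHolonomy U x (plaqWord μ p.1 p.2)))ᴴ) -
          (((2 * ((d : ℝ) - 1))⁻¹ : ℝ) : ℂ) • (plaqSum ρ x μ U - (plaqSum ρ x μ U)ᴴ)‖ ^ 2) := by
  set S := (Finset.univ.erase μ) ×ˢ (Finset.univ : Finset Bool) with hS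
  have hcard : (S.card : ℝ) = 2 * ((d : ℝ) - 1) := card_plaqIndex μ
  have hne : S.Nonempty := by
    obtain ⟨ν, hν⟩ : ∃ ν : Fin d, ν ≠ μ := by
      by_cases h0 : μ = ⟨0, by omega⟩
      · exact ⟨⟨1, by omega⟩, fun h => by rw [h0] at h; exact absurd (congrArg Fin.val h) (by norm_num)⟩
      · exact ⟨⟨0, by omega⟩, fun h => h0 h.symm⟩
    exact ⟨(ν, true), Finset.mem_product.2 ⟨Finset.mem_erase.2 ⟨hν, Finset.mem_univ _⟩, Finset.mem_univ _⟩⟩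
  -- `A = Σ B`
  have hA : plaqSum ρ x μ U - (plaqSum ρ x μ U)ᴴ =
      ∑ p ∈ S, (ρ (wordHolonomy U x (plaqWord μ p.1 p.2)) - (ρ (wordHolonomy U x (plaqWord μ p.1 p.2)))ᴴ) := by
    rw [plaqSum_eq_sum_product, Matrix.conjTranspose_sum, ← Finset.sum_sub_distrib]
  -- per plaquette: `16 (N − Re tr V) = 2‖P + Pᴴ‖² + 2‖B‖²`, `P = 1 − V`, `P − Pᴴ = −B`
  have hcost : ∀ p : Fin d × Bool, 16 * ((N : ℝ) - (ρ (wordHolonomy U x (plaqWord μ p.1 p.2))).trace.re) =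
      2 * ‖((1 : Matrix (Fin N) (Fin N) ℂ) - ρ (wordHolonomy U x (plaqWord μ p.1 p.2))) +
          ((1 : Matrix (Fin N) (Fin N) ℂ) - ρ (wordHolonomy U x (plaqWord μ p.1 p.2)))ᴴ‖ ^ 2 +
        2 * ‖ρ (wordHolonomy U x (plaqWord μ p.1 p.2)) - (ρ (wordHolonomy U x (plaqWord μ p.1 p.2)))ᴴ‖ ^ 2 := by
    intro p
    set V := ρ (wordHolonomy U x (plaqWord μ p.1 p.2)) with hV
    have h1 := UnitaryCayley.re_trace_one_sub (hρ (wordHolonomy U x (plaqWord μ p.1 p.2)))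
    rw [← hV, Matrix.trace_sub, Matrix.trace_one, Complex.sub_re, Fintype.card_fin, Complex.natCast_re] at h1
    have h2 := norm_sq_add_conjTranspose_add ((1 : Matrix (Fin N) (Fin N) ℂ) - V)
    have h3 : ((1 : Matrix (Fin N) (Fin N) ℂ) - V) - ((1 : Matrix (Fin N) (Fin N) ℂ) - V)ᴴ = -(V - Vᴴ) := by
      rw [Matrix.conjTranspose_sub, Matrix.conjTranspose_one]; abel
    rw [h3, norm_neg] at h2
    have h1' : (N : ℝ) - V.trace.re = ‖(1 : Matrix (Fin N) (Fin N) ℂ) - V‖ ^ 2 / 2 := h1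
    rw [h1']
    linarith
  have hvar := card_mul_sum_norm_sub_avg_sq S hne
    (fun p => ρ (wordHolonomy U x (plaqWord μ p.1 p.2)) - (ρ (wordHolonomy U x (plaqWord μ p.1 p.2)))ᴴ)
  beta_reduce at hvar
  rw [hcard] at hvar
  rw [hA]
  have hsum16 : 16 * ((d : ℝ) - 1) * ∑ p ∈ S, ((N : ℝ) - (ρ (wordHolonomy U x (plaqWord μ p.1 p.2))).trace.re) =
      ((d : ℝ) - 1) * ∑ p ∈ S, 16 * ((N : ℝ) - (ρ (wordHolonomy U x (plaqWord μ p.1 p.2))).trace.re) := by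
    rw [Finset.mul_sum, Finset.mul_sum]
    exact Finset.sum_congr rfl fun p _ => by ring
  rw [hsum16]
  simp only [hcost, Finset.sum_add_distrib, ← Finset.mul_sum]
  linarith [hvar]

end SOS

end Equipartition

/-! ## Word-degree bookkeeping: the certificate's matrices have level-4 entries -/

section Entries

variable {ι : Type*} {G : Type*} [Group G] [TopologicalSpace G] (r : LatticeRep G)

/-- Constant matrices have entries in every word space. [folklore] -/
theorem entriesIn_const (S : Set ι) (n : ℕ) (C : Matrix (Fin r.N) (Fin r.N) ℂ) :
    EntriesIn r S n (fun _ : ι → G => C) := fun _ _ =>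
  ⟨const_mem_wordFunctions r S n _, const_mem_wordFunctions r S n _⟩

/-- Sums. [folklore] -/
theorem EntriesIn.add {S : Set ι} {n : ℕ} {M P : (ι → G) → Matrix (Fin r.N) (Fin r.N) ℂ}
    (hM : EntriesIn r S n M) (hP : EntriesIn r S n P) : EntriesIn r S n (fun U => M U + P U) := by
  intro a b
  refine ⟨?_, ?_⟩
  · have e : (fun U => ((M U + P U) a b).re) = (fun U => (M U a b).re) + fun U => (P U a b).re := by
      funext U; simp
    rw [e]; exact Submodule.add_mem _ (hM a b).1 (hP a b).1
  · have e : (fun U => ((M U + P U) a b).im) = (fun U => (M U a b).im) + fun U => (P U a b).im := by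
      funext U; simp
    rw [e]; exact Submodule.add_mem _ (hM a b).2 (hP a b).2

/-- Negation. [folklore] -/
theorem EntriesIn.neg {S : Set ι} {n : ℕ} {M : (ι → G) → Matrix (Fin r.N) (Fin r.N) ℂ}
    (hM : EntriesIn r S n M) : EntriesIn r S n (fun U => -M U) := by
  intro a b
  refine ⟨?_, ?_⟩
  · have e : (fun U => ((-M U) a b).re) = -fun U => (M U a b).re := by funext U; simp
    rw [e]; exact Submodule.neg_mem _ (hM a b).1
  · have e : (fun U => ((-M U) a b).im) = -fun U => (M U a b).im := by funext U; simp
    rw [e]; exact Submodule.neg_mem _ (hM a b).2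

/-- Differences. [folklore] -/
theorem EntriesIn.sub {S : Set ι} {n : ℕ} {M P : (ι → G) → Matrix (Fin r.N) (Fin r.N) ℂ}
    (hM : EntriesIn r S n M) (hP : EntriesIn r S n P) : EntriesIn r S n (fun U => M U - P U) := by
  have h := hM.add r (hP.neg r)
  simpa only [sub_eq_add_neg] using h

/-- Real scalar multiples. [folklore] -/
theorem EntriesIn.smul_real {S : Set ι} {n : ℕ} {M : (ι → G) → Matrix (Fin r.N) (Fin r.N) ℂ}
    (hM : EntriesIn r S n M) (c : ℝ) : EntriesIn r S n (fun U => ((c : ℝ) : ℂ) • M U) := by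
  intro a b
  refine ⟨?_, ?_⟩
  · have e : (fun U => ((((c : ℝ) : ℂ) • M U) a b).re) = c • fun U => (M U a b).re := by
      funext U; simp [Matrix.smul_apply]
    rw [e]; exact Submodule.smul_mem _ c (hM a b).1
  · have e : (fun U => ((((c : ℝ) : ℂ) • M U) a b).im) = c • fun U => (M U a b).im := by
      funext U; simp [Matrix.smul_apply]
    rw [e]; exact Submodule.smul_mem _ c (hM a b).2

/-- Conjugate transposes. [folklore] -/
theorem EntriesIn.conjTranspose {S : Set ι} {n : ℕ} {M : (ι → G) → Matrix (Fin r.N) (Fin r.N) ℂ}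
    (hM : EntriesIn r S n M) : EntriesIn r S n (fun U => (M U)ᴴ) := by
  intro a b
  refine ⟨?_, ?_⟩
  · have e : (fun U => ((M U)ᴴ a b).re) = fun U => (M U b a).re := by
      funext U; simp [Matrix.conjTranspose_apply]
    rw [e]; exact (hM b a).1
  · have e : (fun U => ((M U)ᴴ a b).im) = -fun U => (M U b a).im := by
      funext U; simp [Matrix.conjTranspose_apply]
    rw [e]; exact Submodule.neg_mem _ (hM b a).2

/-- Finite sums. [folklore] -/
theorem EntriesIn.sum {S : Set ι} {n : ℕ} {κ : Type*} (s : Finset κ) {M : κ → (ι → G) → Matrix (Fin r.N) (Fin r.N) ℂ}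
    (hM : ∀ k, EntriesIn r S n (M k)) : EntriesIn r S n (fun U => ∑ k ∈ s, M k U) := by
  classical
  induction s using Finset.induction_on with
  | empty => simpa using entriesIn_const r S n 0
  | insert k s hk ih =>
    have h := (hM k).add r ih
    simpa only [Finset.sum_insert hk] using h

/-- Monotonicity in the degree. [folklore] -/
theorem EntriesIn.mono {S : Set ι} {m n : ℕ} (hmn : m ≤ n) {M : (ι → G) → Matrix (Fin r.N) (Fin r.N) ℂ}
    (hM : EntriesIn r S m M) : EntriesIn r S n M := fun a b =>
  ⟨wordFunctions_mono r le_rfl hmn (hM a b).1, wordFunctions_mono r le_rfl hmn (hM a b).2⟩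

variable {d L : ℕ} {G : Type} [Group G] [TopologicalSpace G] (r : LatticeRep G)

/-- The plaquette words have length `4`. [folklore] -/
theorem length_plaqWord (μ ν : Fin d) (ε : Bool) : (plaqWord μ ν ε).length = 4 := by
  cases ε <;> rfl

/-- ★ The plaquette holonomies through an edge have level-4 entries. [folklore] -/
theorem entriesIn_plaqWord (x : Site d L) (μ ν : Fin d) (ε : Bool) :
    EntriesIn r (Set.univ : Set (Edge d L)) 4 (fun U : GaugeConfig d L G => r.ρ (wordHolonomy U x (plaqWord μ ν ε))) := by
  have h := entriesIn_wordHolonomy r x (plaqWord μ ν ε)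
  rwa [length_plaqWord] at h

/-- `plaqSum` has level-4 entries. [folklore] -/
theorem entriesIn_plaqSum (x : Site d L) (μ : Fin d) :
    EntriesIn r (Set.univ : Set (Edge d L)) 4 (fun U : GaugeConfig d L G => Equipartition.plaqSum r.ρ x μ U) := by
  unfold Equipartition.plaqSum
  exact EntriesIn.sum r _ fun ν => EntriesIn.sum r _ fun ε => entriesIn_plaqWord r x μ ν ε

end Entries

end Summit.QuantumFields.GaugeBoot

end
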